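import Literature.Topology.FourManifolds.RouteMonotone
import HarnessLib

/-!
# Explicit derivative bounds of the K₂ track profile

Topic `Literature/Topology/FourManifolds`; fact seat `provefact-IsStrictHandleSlide.isSurgery`
(R. C. Kirby, *The Topology of 4-Manifolds*, LNM 1374 (1989), Ch. I §4, Fig. 4.2; remaining content:
the named fact (S) `Literature.Topology.FourManifolds.FramedLink.IsStrictHandleSlide.slideModel`).
`K1Loop2Data` (the fingertip with controlled descent) and `RouteHyp` (the route monotonicity) take
as inputs a bound `Mρ` of the derivative of the virtual profile `ρt = (1 - κ₀) ρrise + Sr` of a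
`K2LiteData` and a bound `VX` of the abscissa speed `Xl' = ρt' (Hh) · Hh'` on the landing window.
Both are explicit in a bound `C_T` of `smoothTransition'` (`SlideConstantsBase.lean`):
`ρt' ≤ (1 - κ₀) C_T / (hpl - f a) + C_T / (hr1 - hr0)` (`K2LiteData.deriv_ρt_le`) and
`Xl' ≤ Mρ · MH` on `[b - ε, b + ε]` (`K2LiteData.deriv_Xl_le`).

## References

* R. C. Kirby, *The Topology of 4-Manifolds*, LNM 1374, Springer (1989), Ch. I §4. [Kirby1989]
-/

open scoped Topology ContDiff
open Set Real Filter

noncomputable section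

namespace Literature.Topology.FourManifolds

/-- The derivative of a smooth step is at most `C_T / (b - a)` if `smoothTransition' ≤ C_T`. [folklore] -/
theorem deriv_smoothStep_le_of {a b CT : ℝ} (hab : a < b) (hCT : ∀ x, deriv smoothTransition x ≤ CT) (x : ℝ) :
    deriv (smoothStep a b) x ≤ CT / (b - a) := by
  rw [(hasDerivAt_smoothStep a b x).deriv, div_eq_mul_inv]
  exact mul_le_mul_of_nonneg_right (hCT _) (inv_nonneg.2 (by linarith))

namespace K2LiteData

variable (d : K2LiteData)

/-- **The explicit bound of the virtual profile's derivative.** [folklore] -/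
def Mρ_of (CT : ℝ) : ℝ := (1 - d.κ₀) * (CT / (d.hpl - d.f d.a)) + CT / (d.hr1 - d.hr0)

/-- `deriv_ρt_le` (auxiliary). [folklore] -/
theorem deriv_ρt_le {CT : ℝ} (hCT : ∀ x, deriv smoothTransition x ≤ CT) (h : ℝ) : deriv d.ρt h ≤ d.Mρ_of CT := by
  rw [(d.hasDerivAt_ρt h).deriv, Mρ_of]
  have h1 := deriv_smoothStep_le_of d.hpl_gt hCT h
  have h2 := deriv_smoothStep_le_of d.hr_lt hCT h
  have hκ : 0 ≤ 1 - d.κ₀ := by linarith [d.κ₀_lt_one]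
  nlinarith [mul_le_mul_of_nonneg_left h1 hκ]

/-- `Mρ_of_pos` (auxiliary). [folklore] -/
theorem Mρ_of_pos {CT : ℝ} (hCT : ∀ x, deriv smoothTransition x ≤ CT) : 0 < d.Mρ_of CT := by
  -- `ρt' > 0` somewhere (at the tip level), so the bound is positive
  have ht := d.tD_mem
  have hzone : d.Sr (d.Hh d.tD) ∈ Icc (d.κ₀ - 3 * d.κD) (d.κ₀ + 3 * d.κD) := d.Sr_zone ⟨le_rfl, d.tD_lt_tL.le⟩
  have hX := d.vmin_le_deriv_Xl ⟨ht.1.le, ht.2.le⟩ hzone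
  rw [(d.hasDerivAt_Xl d.tD).deriv] at hX
  have hH := d.deriv_Hh_le_MH ⟨ht.1.le, by linarith [ht.2, d.ε_pos]⟩
  have hH0 := d.deriv_Hh_pos (t := d.tD) (by linarith [ht.2, d.ε_pos])
  have hρ := d.deriv_ρt_le hCT (d.Hh d.tD)
  have hv := d.vmin_pos
  by_contra hle
  have hle' : d.Mρ_of CT ≤ 0 := le_of_not_gt hle
  have : deriv d.ρt (d.Hh d.tD) * deriv d.Hh d.tD ≤ 0 :=
    mul_nonpos_of_nonpos_of_nonneg (hρ.trans hle') hH0.le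
  linarith

/-- **The abscissa speed is at most `Mρ · MH` on the landing window.** [folklore] -/
theorem deriv_Xl_le {CT : ℝ} (hCT : ∀ x, deriv smoothTransition x ≤ CT) {τ : ℝ} (hτ : τ ∈ Icc (d.b - d.ε) (d.b + d.ε)) :
    deriv d.Xl τ ≤ d.Mρ_of CT * d.MH := by
  rw [(d.hasDerivAt_Xl τ).deriv]
  have hH := d.deriv_Hh_le_MH hτ
  have hH0 := d.deriv_Hh_pos (t := τ) hτ.2
  have hρ := d.deriv_ρt_le hCT (d.Hh τ)
  have hρ0 := d.deriv_ρt_nonneg (d.Hh τ)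
  calc deriv d.ρt (d.Hh τ) * deriv d.Hh τ ≤ d.Mρ_of CT * deriv d.Hh τ := mul_le_mul_of_nonneg_right hρ hH0.le
    _ ≤ d.Mρ_of CT * d.MH := mul_le_mul_of_nonneg_left hH (hρ0.trans hρ)

end K2LiteData

end Literature.Topology.FourManifolds
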